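import Summits.QuantumFields.BalabanUV.Beta.FP.TowerHN2RowMixedDoor
import Summits.QuantumFields.BalabanUV.Beta.CompositeOneShotJetsGraded

/-!
# `BalabanUV.Beta.FP.TowerHN2RowMixedDoorG` — road «FP», binder row D1, ROUTE T, (T1) (an2 W-7 ∕ V11-DELTA §2; XREAD-1 B5; an2 W-2 (A)(1)): **`TowerHN2RowMixedDoor` §1–§2 WITH
# THE DOOR's MIXED TABLE READ AT THE GRADED RECORD** — `hJΛ2_of_mixedLock_of_mixedGauge_door` VERBATIM but for ONE token in its displays:
# the (0.4)-sym composite's mixed table `(tabsComp (n+2) …).mixFF` ↦ the GRADED record's `(tabsCompG (n+2) …).mixFF` (an2 PART 92 `CompositeOneShotJetsGraded.tabsCompG`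
# = `tabsComp … with mixFF := compMixG …`; `= compMixG (ctrOff 4 Lc) Lc (n+2)` and `= (tabsRecG Lc Pn n).mixFF` by `rfl`, chair leaf-03 g67 XV1 K2∕K3), so that the v11∕v10G
# ONE file's `hM₂′` (V11-DELTA (T1)) and an2 PART 94's graded N-record reading meet these letters; the constraint-Hessian table `(tabsComp …).H` (`Ĉ_β`, (J-ΛS)∕(K2b)) is
# UNCHANGED (the graded record keeps `H`; PART 89 keeps the same spelling)

WHY (journal: road XREAD-1 l.69131 B5; an2 W-2 l.69137 (A)(1)–(2), W-4 l.69145).  v10's ONE file derives `hHN₂` through `TowerHN2RowMixedDoor` (this file's source) →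
`TowerHN2RowDoor`; both take the mixed table BY TEXT, so (T1)'s `hM₂′` is refused (farm: «hM₂ n B has type … compMixG … but is expected … (tabsComp …).mixFF …»).  THIS FILE is the
first of the road's graded door letters: the TEXT twin of §2 ONLY (no mathematics moves — the mixed display `hΛ₂` and the two mixed words are re-spelled at the graded
table); §0's algebra and §1 `hJΛ2'_of_wardRow_door` (whose statement names `M₂` abstractly and carries NO table text — the gate's dedup confirmed it identical) are
IMPORTED BY NAME, as is the mixed lock (`TowerHN2RowMixed.mixed_lock_combine`).  Generator
`g61/rec/mkMixedDoorG.py` over the TREE bytes (token count 4 in §2; name `… ↦ …_graded`).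

WHAT ([folklore] `Matrix`∕`Finset` bookkeeping BY NAME; no `def`, no `def … : Prop`, nothing cited, 0 sorry): §1 **`hJΛ2'_of_wardRow_door`**; §2
**`hJΛ2_of_mixedLock_of_mixedGauge_door_graded (p q α β)`** — statements = the originals' with the one token moved.  WHAT THIS IS NOT: not the door's value or form under (T1)
(an2 FINDING AN2-84-1: with `compMixG` the (K2b) remainder is absent and the door becomes `WNG − WN` — by value first, nothing typed here); nothing of Bałaban's asserted, valued or
discharged; 0 estimates; 0∕4 row-D1 binders (hW, hR, D1Tel, D1Rep); ROOT M‴ p325680 ∕ P5c ∕ D6 untouched; NOT (C1), NOT (T-ID), NOT D1, NEVER «G-an2-4 closed», NOT BetaPertH,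
NOT continuum, NOT Clay.

HONEST DEPENDENCY (page 1, mandatory): continuum YM on T⁴ ⇐ BetaPertH ∧ nine spine estimates (0/9 proved); BetaPertH ⇐ (D1) ∧ (D4) ∧ CAP+tail;
G-an2-4 gates asym, D1 and NE2/3/4.  HONEST FRAMING (cell contract, verbatim): «discharging `BetaPertH` makes Bałaban's UV stability UNCONDITIONAL —
a real constructive-QFT result; it is NOT the continuum limit and NOT the Clay problem.»  ABSOLUTE RULE (cell charter, verbatim): «No internally-minted
statement may enter as a cited fact. Every hypothesis is either kernel-proved in this package or a verbatim quotation of a PUBLISHED theorem with page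
reference. The manuscript(s) under audit are NOT citable for their own disputed steps — they are the thing under adjudication; programme-internal
(2001/route/tribunal) claims are never citable.»  Road «FP» OWNER, b2b-balaban-beta-d1-p3 gen 61, 2026-08-30.  No existing file touched.
-/

noncomputable section

open scoped BigOperators

namespace Summit.QuantumFields.BalabanUV.Beta.FP.TowerHN2RowMixedDoorG

open Finset Matrix

open Finset Matrix
open Literature.MathematicalPhysics.QuantumFieldTheory
open Literature.MathematicalPhysics.QuantumFieldTheory.Balaban1983to89
open Literature.MathematicalPhysics.QuantumFieldTheory.Balaban1983to89.Beta
open B4TorusKernel.MultiPeriod (translate)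
open B5Prop11Plancherel (fine)
open B6Lemma24Torus (pbox)
open AffineAveraging (Site box toSite)
open AveragingContoursRooted (ctr ctrOff)
open OneStepResolventKernel (Fib)
open StepJetData (wilsonA)
open WilsonBiStencil (wilsonW₂)
open BalabanStepW2 (M2Of)
open Summit.QuantumFields.BalabanUV.Beta.TameKernelCalculus (trK)
open Summit.QuantumFields.BalabanUV.Beta.BorderedHessian (sgnK)
open Summit.QuantumFields.BalabanUV.Beta.SymShiftedSpread (bhKStepSh)
open Summit.QuantumFields.BalabanUV.Beta.DshAn1 (Dsh)
open Summit.QuantumFields.BalabanUV.Beta.AxialDressingRooted (one_le_of_neZero)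
open Summit.QuantumFields.BalabanUV.Beta.CompositeOneShotJets (tabsComp)
open Summit.QuantumFields.BalabanUV.Beta.CompositeOneShotJetData (Roots Pins AN WN)
open Summit.QuantumFields.BalabanUV.Beta.FP.KernelPeriodisationFib (Idx perF)
open Summit.QuantumFields.BalabanUV.Beta.FP.KernelPeriodisationFibLoc (dper)
open Summit.QuantumFields.BalabanUV.Beta.FP.TorusGaugeCovariance (tgrad)
open Summit.QuantumFields.BalabanUV.Beta.FP.TorusGaugeCovariancePairing (wrapPt)
open Summit.QuantumFields.BalabanUV.Beta.FP.TorusCompositeObjects (towerTorus)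
open Summit.QuantumFields.BalabanUV.Beta.FP.TowerHN1Row (map_smul_of_linear)
open Summit.QuantumFields.BalabanUV.Beta.FP.TowerQN1RowJet (direction_add_exact_eq_smul_col)
open Summit.QuantumFields.BalabanUV.Beta.FP.TowerHN2RowMixed (mixed_lock_combine)
open Summit.QuantumFields.BalabanUV.Beta.CompositeOneShotJetsGraded (tabsCompG)
open Summit.QuantumFields.BalabanUV.Beta.FP.TowerHN2RowMixedDoor (commutator_pair_of_wardRow_door)



/-! ## §2 The displayed row (J-Λ₂) entrywise, with the door carried -/

section Mixed

variable {Lc : ℕ} [NeZero Lc] (M : Fin (3 + 1) → ℕ) [∀ μ, NeZero (M μ)] (n : ℕ) (c : ℝ) (Pn : Pins)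
  {κ : Type*} [DecidableEq κ] (yN : κ → Site (3 + 1)) (μN : κ → Fin (3 + 1))
  (hv : (κ → ℝ) → (↥(pbox (towerTorus Lc (fine Lc M) (n + 1))) × Fin (3 + 1) → ℝ))
  (hhvl : ∀ (r : ℝ) (x y : κ → ℝ), hv (r • x + y) = r • hv x + hv y)
  (lv : (κ → ℝ) → (↥(pbox (towerTorus Lc (fine Lc M) (n + 1))) → ℝ))
  (hlv : ∀ (r : ℝ) (x y : κ → ℝ), lv (r • x + y) = r • lv x + lv y)
  (hJW : ∀ (a : κ) (b : ↥(pbox (towerTorus Lc (fine Lc M) (n + 1))) × Fin (3 + 1)), hv (Pi.single a 1) b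
      = perF (towerTorus Lc (fine Lc M) (n + 1)) (AN (Roots.ctr Lc) (n + 1)) (b.1, Sum.inl b.2)
          (wrapPt (towerTorus Lc (fine Lc M) (n + 1)) (((Lc ^ (n + 1 + 1) : ℕ) : ℤ) • yN a), Sum.inr (μN a))
        - ∑ s : ↥(pbox (towerTorus Lc (fine Lc M) (n + 1))), tgrad (towerTorus Lc (fine Lc M) (n + 1)) (b.1, Sum.inl b.2) s * lv (Pi.single a 1) s)
  -- THE MULTIPLIER-COLUMN FAMILY `hm` (linear) with its junction letter `hJM`: the source `e_a`'s coarse multiplier weights are the `Ŝ`-column of PART 23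
  (hm : (κ → ℝ) → (↥(pbox M) × Fin (3 + 1) → ℝ))
  (hml : ∀ (r : ℝ) (x y : κ → ℝ), hm (r • x + y) = r • hm x + hm y)
  (hJM : ∀ (a : κ) (β : ↥(pbox M) × Fin (3 + 1)), hm (Pi.single a 1) β
      = perF (towerTorus Lc (fine Lc M) (n + 1)) (AN (Roots.ctr Lc) (n + 1)) (wrapPt (towerTorus Lc (fine Lc M) (n + 1)) (((Lc ^ (n + 1 + 1) : ℕ) : ℤ) • (β.1 : Site (3 + 1))), Sum.inr β.2)
              (wrapPt (towerTorus Lc (fine Lc M) (n + 1)) (((Lc ^ (n + 1 + 1) : ℕ) : ℤ) • yN a), Sum.inr (μN a)))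
  -- THE MIXED TABLE LETTER: the row's wound even mixed table `ℳ̂₂ᵉ` (PART 23), fine field bond `b`, coarse multiplier bond `β`, `ff` block
  (M₂ : ↥(pbox (towerTorus Lc (fine Lc M) (n + 1))) × Fin (3 + 1) → ↥(pbox M) × Fin (3 + 1) → Matrix (↥(pbox (towerTorus Lc (fine Lc M) (n + 1))) × Fin (3 + 1)) (↥(pbox (towerTorus Lc (fine Lc M) (n + 1))) × Fin (3 + 1)) ℝ)
  (hM₂ : ∀ (b : ↥(pbox (towerTorus Lc (fine Lc M) (n + 1))) × Fin (3 + 1)) (β : ↥(pbox M) × Fin (3 + 1)), M₂ b β = (perF (towerTorus Lc (fine Lc M) (n + 1)) (dper (towerTorus Lc (fine Lc M) (n + 1)) (fun X Z i₁ i₂ => ∑' m : Site (3 + 1),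
              ((1 / 2 : ℝ) • (M2Of 3 (Lc ^ (n + 1 + 1)) (tabsCompG (n + 1 + 1) (one_le_of_neZero Lc) (Roots.ctr Lc).hr (Pn.cM (n + 1 + 1))).mixFF 0 b.2 (b.1 : Site (3 + 1)) β.2 (translate M (β.1 : Site (3 + 1)) m)
                + sgnK (trK (M2Of 3 (Lc ^ (n + 1 + 1)) (tabsCompG (n + 1 + 1) (one_le_of_neZero Lc) (Roots.ctr Lc).hr (Pn.cM (n + 1 + 1))).mixFF 0 b.2 (b.1 : Site (3 + 1)) β.2 (translate M (β.1 : Site (3 + 1)) m))))) X Z i₁ i₂))).submatrix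
            (fun b : ↥(pbox (towerTorus Lc (fine Lc M) (n + 1))) × Fin (3 + 1) => ((b.1, Sum.inl b.2) : Idx (towerTorus Lc (fine Lc M) (n + 1)) (Fib 3)))
            (fun b : ↥(pbox (towerTorus Lc (fine Lc M) (n + 1))) × Fin (3 + 1) => ((b.1, Sum.inl b.2) : Idx (towerTorus Lc (fine Lc M) (n + 1)) (Fib 3))))
  -- THE DISPLAY of #7's remainder `Λ₂` as the MIXED SECTOR with weight `cM₂`
  (Λ₁ : (κ → ℝ) → Matrix (↥(pbox (towerTorus Lc (fine Lc M) (n + 1))) × Fin (3 + 1)) (↥(pbox (towerTorus Lc (fine Lc M) (n + 1))) × Fin (3 + 1)) ℝ)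
  (Λ₂ : (κ → ℝ) → (κ → ℝ) → Matrix (↥(pbox (towerTorus Lc (fine Lc M) (n + 1))) × Fin (3 + 1)) (↥(pbox (towerTorus Lc (fine Lc M) (n + 1))) × Fin (3 + 1)) ℝ) (cM₂ : ℝ)
  (hΛ₂ : ∀ v v', Λ₂ v v' = cM₂ • ∑ b : ↥(pbox (towerTorus Lc (fine Lc M) (n + 1))) × Fin (3 + 1), ∑ β : ↥(pbox M) × Fin (3 + 1), (hv v b * hm v' β + hv v' b * hm v β) • M₂ b β)
  (r : ℝ) (a a' : κ)
  -- THE MIXED LOCK ROW and THE RESIDUAL GAUGE ROW (J-Λ₂′)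
  (hcM₂ : cM₂ * r * r = 1)
  -- THE DOOR (v10): (J-Λ₂′) with the door-valued residual row moved right (`TowerHN2RowMixedDoor.hJΛ2'_of_wardRow_door`'s conclusion)
  (D : Matrix (↥(pbox (towerTorus Lc (fine Lc M) (n + 1))) × Fin (3 + 1)) (↥(pbox (towerTorus Lc (fine Lc M) (n + 1))) × Fin (3 + 1)) ℝ)
  (hJΛ₂' : c • (Matrix.diagonal (fun b : ↥(pbox (towerTorus Lc (fine Lc M) (n + 1))) × Fin (3 + 1) => lv (r • (Pi.single a (1 : ℝ) : κ → ℝ)) b.1) * Λ₁ (r • (Pi.single a' (1 : ℝ) : κ → ℝ))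
              - Λ₁ (r • (Pi.single a' (1 : ℝ) : κ → ℝ)) * Matrix.diagonal (fun b : ↥(pbox (towerTorus Lc (fine Lc M) (n + 1))) × Fin (3 + 1) => lv (r • (Pi.single a (1 : ℝ) : κ → ℝ)) b.1)
              + (Matrix.diagonal (fun b : ↥(pbox (towerTorus Lc (fine Lc M) (n + 1))) × Fin (3 + 1) => lv (r • (Pi.single a' (1 : ℝ) : κ → ℝ)) b.1) * Λ₁ (r • (Pi.single a (1 : ℝ) : κ → ℝ))
                - Λ₁ (r • (Pi.single a (1 : ℝ) : κ → ℝ)) * Matrix.diagonal (fun b : ↥(pbox (towerTorus Lc (fine Lc M) (n + 1))) × Fin (3 + 1) => lv (r • (Pi.single a' (1 : ℝ) : κ → ℝ)) b.1)))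
      = (cM₂ * r) • ∑ b : ↥(pbox (towerTorus Lc (fine Lc M) (n + 1))) × Fin (3 + 1), ∑ β : ↥(pbox M) × Fin (3 + 1),
          ((∑ s : ↥(pbox (towerTorus Lc (fine Lc M) (n + 1))), tgrad (towerTorus Lc (fine Lc M) (n + 1)) (b.1, Sum.inl b.2) s * lv (r • (Pi.single a (1 : ℝ) : κ → ℝ)) s)
              * perF (towerTorus Lc (fine Lc M) (n + 1)) (AN (Roots.ctr Lc) (n + 1)) (wrapPt (towerTorus Lc (fine Lc M) (n + 1)) (((Lc ^ (n + 1 + 1) : ℕ) : ℤ) • (β.1 : Site (3 + 1))), Sum.inr β.2)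
              (wrapPt (towerTorus Lc (fine Lc M) (n + 1)) (((Lc ^ (n + 1 + 1) : ℕ) : ℤ) • yN a'), Sum.inr (μN a'))
            + (∑ s : ↥(pbox (towerTorus Lc (fine Lc M) (n + 1))), tgrad (towerTorus Lc (fine Lc M) (n + 1)) (b.1, Sum.inl b.2) s * lv (r • (Pi.single a' (1 : ℝ) : κ → ℝ)) s)
              * perF (towerTorus Lc (fine Lc M) (n + 1)) (AN (Roots.ctr Lc) (n + 1)) (wrapPt (towerTorus Lc (fine Lc M) (n + 1)) (((Lc ^ (n + 1 + 1) : ℕ) : ℤ) • (β.1 : Site (3 + 1))), Sum.inr β.2)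
              (wrapPt (towerTorus Lc (fine Lc M) (n + 1)) (((Lc ^ (n + 1 + 1) : ℕ) : ℤ) • yN a), Sum.inr (μN a))) • M₂ b β
        - (cM₂ * r) • D)

include hhvl hlv hJW hml hJM hM₂ hΛ₂ hcM₂ hJΛ₂' in
/-- [folklore] **`hJΛ2_of_mixedLock_of_mixedGauge_door_graded` — (J-Λ₂) FROM THE MIXED DISPLAY, THE LOCK `hcM₂` AND (J-Λ₂′)−door**: at `(a, a′)`, for every entry,
`(Λ₂ (r•e_a) (r•e_{a′}) + c•([E_a, Λ₁(r•e_{a′})] + [E_{a′}, Λ₁(r•e_a)])) (p,α) (q,β)` = PART 23 §4's two mixed words `+ (−(cM₂·r) • D) (p,α) (q,β)` (`mixed_lock_combine` BY NAME). -/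
theorem hJΛ2_of_mixedLock_of_mixedGauge_door_graded (p q : ↥(pbox (towerTorus Lc (fine Lc M) (n + 1)))) (α β : Fin (3 + 1)) :
    (Λ₂ (r • (Pi.single a (1 : ℝ) : κ → ℝ)) (r • (Pi.single a' (1 : ℝ) : κ → ℝ))
            + c • (Matrix.diagonal (fun b : ↥(pbox (towerTorus Lc (fine Lc M) (n + 1))) × Fin (3 + 1) => lv (r • (Pi.single a (1 : ℝ) : κ → ℝ)) b.1) * Λ₁ (r • (Pi.single a' (1 : ℝ) : κ → ℝ))
              - Λ₁ (r • (Pi.single a' (1 : ℝ) : κ → ℝ)) * Matrix.diagonal (fun b : ↥(pbox (towerTorus Lc (fine Lc M) (n + 1))) × Fin (3 + 1) => lv (r • (Pi.single a (1 : ℝ) : κ → ℝ)) b.1)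
              + (Matrix.diagonal (fun b : ↥(pbox (towerTorus Lc (fine Lc M) (n + 1))) × Fin (3 + 1) => lv (r • (Pi.single a' (1 : ℝ) : κ → ℝ)) b.1) * Λ₁ (r • (Pi.single a (1 : ℝ) : κ → ℝ))
                - Λ₁ (r • (Pi.single a (1 : ℝ) : κ → ℝ)) * Matrix.diagonal (fun b : ↥(pbox (towerTorus Lc (fine Lc M) (n + 1))) × Fin (3 + 1) => lv (r • (Pi.single a' (1 : ℝ) : κ → ℝ)) b.1)))) (p, α) (q, β)
      = (∑ u : ↥(pbox (towerTorus Lc (fine Lc M) (n + 1))), ∑ κ : Fin (3 + 1), ∑ w : ↥(pbox M), ∑ ρ : Fin (3 + 1),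
          perF (towerTorus Lc (fine Lc M) (n + 1)) (AN (Roots.ctr Lc) (n + 1)) (u, Sum.inl κ) (wrapPt (towerTorus Lc (fine Lc M) (n + 1)) (((Lc ^ (n + 1 + 1) : ℕ) : ℤ) • yN a), Sum.inr (μN a))
            * (perF (towerTorus Lc (fine Lc M) (n + 1)) (AN (Roots.ctr Lc) (n + 1)) (wrapPt (towerTorus Lc (fine Lc M) (n + 1)) (((Lc ^ (n + 1 + 1) : ℕ) : ℤ) • (w : Site (3 + 1))), Sum.inr ρ) (wrapPt (towerTorus Lc (fine Lc M) (n + 1)) (((Lc ^ (n + 1 + 1) : ℕ) : ℤ) • yN a'), Sum.inr (μN a'))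
                * perF (towerTorus Lc (fine Lc M) (n + 1)) (dper (towerTorus Lc (fine Lc M) (n + 1)) (fun X Z i₁ i₂ => ∑' m : Site (3 + 1),
            ((1 / 2 : ℝ) • (M2Of 3 (Lc ^ (n + 1 + 1)) (tabsCompG (n + 1 + 1) (one_le_of_neZero Lc) (Roots.ctr Lc).hr (Pn.cM (n + 1 + 1))).mixFF 0 κ (u : Site (3 + 1)) ρ (translate M (w : Site (3 + 1)) m) + sgnK (trK (M2Of 3 (Lc ^ (n + 1 + 1)) (tabsCompG (n + 1 + 1) (one_le_of_neZero Lc) (Roots.ctr Lc).hr (Pn.cM (n + 1 + 1))).mixFF 0 κ (u : Site (3 + 1)) ρ (translate M (w : Site (3 + 1)) m))))) X Z i₁ i₂)) (p, Sum.inl α) (q, Sum.inl β)))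
          + (∑ u : ↥(pbox (towerTorus Lc (fine Lc M) (n + 1))), ∑ κ : Fin (3 + 1), ∑ w : ↥(pbox M), ∑ ρ : Fin (3 + 1),
          perF (towerTorus Lc (fine Lc M) (n + 1)) (AN (Roots.ctr Lc) (n + 1)) (u, Sum.inl κ) (wrapPt (towerTorus Lc (fine Lc M) (n + 1)) (((Lc ^ (n + 1 + 1) : ℕ) : ℤ) • yN a'), Sum.inr (μN a'))
            * (perF (towerTorus Lc (fine Lc M) (n + 1)) (AN (Roots.ctr Lc) (n + 1)) (wrapPt (towerTorus Lc (fine Lc M) (n + 1)) (((Lc ^ (n + 1 + 1) : ℕ) : ℤ) • (w : Site (3 + 1))), Sum.inr ρ) (wrapPt (towerTorus Lc (fine Lc M) (n + 1)) (((Lc ^ (n + 1 + 1) : ℕ) : ℤ) • yN a), Sum.inr (μN a))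
                * perF (towerTorus Lc (fine Lc M) (n + 1)) (dper (towerTorus Lc (fine Lc M) (n + 1)) (fun X Z i₁ i₂ => ∑' m : Site (3 + 1),
            ((1 / 2 : ℝ) • (M2Of 3 (Lc ^ (n + 1 + 1)) (tabsCompG (n + 1 + 1) (one_le_of_neZero Lc) (Roots.ctr Lc).hr (Pn.cM (n + 1 + 1))).mixFF 0 κ (u : Site (3 + 1)) ρ (translate M (w : Site (3 + 1)) m) + sgnK (trK (M2Of 3 (Lc ^ (n + 1 + 1)) (tabsCompG (n + 1 + 1) (one_le_of_neZero Lc) (Roots.ctr Lc).hr (Pn.cM (n + 1 + 1))).mixFF 0 κ (u : Site (3 + 1)) ρ (translate M (w : Site (3 + 1)) m))))) X Z i₁ i₂)) (p, Sum.inl α) (q, Sum.inl β)))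
        + (-(cM₂ * r) • D) (p, α) (q, β) := by
  -- (J-W″) solved for the nested direction, and the multiplier columns along `r•e_a`
  have hva : ∀ a₀ : κ, hv (r • (Pi.single a₀ (1 : ℝ) : κ → ℝ)) = (r • fun b : ↥(pbox (towerTorus Lc (fine Lc M) (n + 1))) × Fin (3 + 1) =>
        perF (towerTorus Lc (fine Lc M) (n + 1)) (AN (Roots.ctr Lc) (n + 1)) (b.1, Sum.inl b.2)
          (wrapPt (towerTorus Lc (fine Lc M) (n + 1)) (((Lc ^ (n + 1 + 1) : ℕ) : ℤ) • yN a₀), Sum.inr (μN a₀)))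
      - (fun b : ↥(pbox (towerTorus Lc (fine Lc M) (n + 1))) × Fin (3 + 1) =>
            ∑ s : ↥(pbox (towerTorus Lc (fine Lc M) (n + 1))), tgrad (towerTorus Lc (fine Lc M) (n + 1)) (b.1, Sum.inl b.2) s * lv (r • (Pi.single a₀ (1 : ℝ) : κ → ℝ)) s) := fun a₀ =>
    eq_sub_of_add_eq (direction_add_exact_eq_smul_col M n yN μN hv hhvl lv hlv hJW r a₀)
  have hma : ∀ (a₀ : κ) (β₀ : ↥(pbox M) × Fin (3 + 1)), hm (r • (Pi.single a₀ (1 : ℝ) : κ → ℝ)) β₀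
      = r * perF (towerTorus Lc (fine Lc M) (n + 1)) (AN (Roots.ctr Lc) (n + 1)) (wrapPt (towerTorus Lc (fine Lc M) (n + 1)) (((Lc ^ (n + 1 + 1) : ℕ) : ℤ) • (β₀.1 : Site (3 + 1))), Sum.inr β₀.2)
              (wrapPt (towerTorus Lc (fine Lc M) (n + 1)) (((Lc ^ (n + 1 + 1) : ℕ) : ℤ) • yN a₀), Sum.inr (μN a₀)) := fun a₀ β₀ => by
    rw [map_smul_of_linear hm hml, Pi.smul_apply, smul_eq_mul, hJM]
  -- the entry, combined by the lock into the `colN̂–Ŝ` words over the road's table letter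
  have key : (Λ₂ (r • (Pi.single a (1 : ℝ) : κ → ℝ)) (r • (Pi.single a' (1 : ℝ) : κ → ℝ))
            + c • (Matrix.diagonal (fun b : ↥(pbox (towerTorus Lc (fine Lc M) (n + 1))) × Fin (3 + 1) => lv (r • (Pi.single a (1 : ℝ) : κ → ℝ)) b.1) * Λ₁ (r • (Pi.single a' (1 : ℝ) : κ → ℝ))
              - Λ₁ (r • (Pi.single a' (1 : ℝ) : κ → ℝ)) * Matrix.diagonal (fun b : ↥(pbox (towerTorus Lc (fine Lc M) (n + 1))) × Fin (3 + 1) => lv (r • (Pi.single a (1 : ℝ) : κ → ℝ)) b.1)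
              + (Matrix.diagonal (fun b : ↥(pbox (towerTorus Lc (fine Lc M) (n + 1))) × Fin (3 + 1) => lv (r • (Pi.single a' (1 : ℝ) : κ → ℝ)) b.1) * Λ₁ (r • (Pi.single a (1 : ℝ) : κ → ℝ))
                - Λ₁ (r • (Pi.single a (1 : ℝ) : κ → ℝ)) * Matrix.diagonal (fun b : ↥(pbox (towerTorus Lc (fine Lc M) (n + 1))) × Fin (3 + 1) => lv (r • (Pi.single a' (1 : ℝ) : κ → ℝ)) b.1)))) (p, α) (q, β)
      = ∑ b : ↥(pbox (towerTorus Lc (fine Lc M) (n + 1))) × Fin (3 + 1), ∑ β₀ : ↥(pbox M) × Fin (3 + 1),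
          (perF (towerTorus Lc (fine Lc M) (n + 1)) (AN (Roots.ctr Lc) (n + 1)) (b.1, Sum.inl b.2)
              (wrapPt (towerTorus Lc (fine Lc M) (n + 1)) (((Lc ^ (n + 1 + 1) : ℕ) : ℤ) • yN a), Sum.inr (μN a))
              * perF (towerTorus Lc (fine Lc M) (n + 1)) (AN (Roots.ctr Lc) (n + 1)) (wrapPt (towerTorus Lc (fine Lc M) (n + 1)) (((Lc ^ (n + 1 + 1) : ℕ) : ℤ) • (β₀.1 : Site (3 + 1))), Sum.inr β₀.2)
              (wrapPt (towerTorus Lc (fine Lc M) (n + 1)) (((Lc ^ (n + 1 + 1) : ℕ) : ℤ) • yN a'), Sum.inr (μN a'))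
            + perF (towerTorus Lc (fine Lc M) (n + 1)) (AN (Roots.ctr Lc) (n + 1)) (b.1, Sum.inl b.2)
              (wrapPt (towerTorus Lc (fine Lc M) (n + 1)) (((Lc ^ (n + 1 + 1) : ℕ) : ℤ) • yN a'), Sum.inr (μN a'))
              * perF (towerTorus Lc (fine Lc M) (n + 1)) (AN (Roots.ctr Lc) (n + 1)) (wrapPt (towerTorus Lc (fine Lc M) (n + 1)) (((Lc ^ (n + 1 + 1) : ℕ) : ℤ) • (β₀.1 : Site (3 + 1))), Sum.inr β₀.2)
              (wrapPt (towerTorus Lc (fine Lc M) (n + 1)) (((Lc ^ (n + 1 + 1) : ℕ) : ℤ) • yN a), Sum.inr (μN a))) * M₂ b β₀ (p, α) (q, β) - (cM₂ * r) * D (p, α) (q, β) := by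
    rw [Matrix.add_apply, hJΛ₂', hΛ₂, hva a, hva a']
    simp only [hma, Pi.sub_apply, Pi.smul_apply, smul_eq_mul, Matrix.smul_apply, Matrix.sum_apply, Matrix.sub_apply]
    rw [← add_sub_assoc, sub_left_inj]
    exact mixed_lock_combine cM₂ r hcM₂ _ _ _ _ _ _ _
  rw [key, Matrix.smul_apply, smul_eq_mul, neg_mul, ← sub_eq_add_neg, sub_left_inj]
  simp only [add_mul, Finset.sum_add_distrib, hM₂, Matrix.submatrix_apply, Fintype.sum_prod_type, mul_assoc]

end Mixed

end Summit.QuantumFields.BalabanUV.Beta.FP.TowerHN2RowMixedDoorG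

end
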